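import Summits.HodgeConjecture.HodgeConjecture.Theses.BoundaryReadout
import Summits.HodgeConjecture.HodgeConjecture.Theses.LinearSystemTorelli
import Summits.HodgeConjecture.HodgeConjecture.Theorems.BoundaryReadoutAbsoluteReductionStubAbsoluteOfIso
import Summits.HodgeConjecture.HodgeConjecture.Theorems.QbarEnvelopeEnvelopeStubNumberFieldModel
import Literature.AlgebraicGeometry.HodgeTheory.HodgeGenericQbarDescentFiniteMonodromyInputs
import Literature.AlgebraicGeometry.HodgeTheory.IsoTransport
import Literature.Barriers.HodgeConjecture.ConjugateVarietiesProofs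
import HarnessLib

/-!
# Route `BoundaryReadout` — crux `AbsoluteReduction` (stmt-HodgeConjecture-15945):
# the crux modulo Voisin's SPREAD WITH A GLOBAL FLAT SECTION (printed verbatim)

Conditional file for the crux item stmt-HodgeConjecture-15945 (`--workitem`; it closes nothing by
itself). Companion of `Theorems/BoundaryReadoutAbsoluteReductionOfEtaleTrivialisation.lean` (crux ⟸
`hA` ∧ stmt-16363 ∧ stmt-1071, `hA` = an étale `ℚ̄`-neighbourhood trivialising the monodromy of an
absolute class at a `ℚ̄`-generic point): here the arithmetic hypothesis is taken one step LATER and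
in the exact shape printed by Voisin (*Hodge loci and absolute Hodge classes*, Compositio 143 (2007),
§3, first sentence of the proof of Prop. 1.2, for an absolute class): *"there exist smooth
irreducible quasi-projective varieties `𝒳, T` defined over `ℚ̄`, a projective morphism `π : 𝒳 → T`,
and a locally constant global section `α̃ ∈ H⁰(T, R^{2k}π_*ℚ)`, such that `X` is one fiber of `π` and
`α` is the restriction of `α̃` to this fiber"* (Charles–Schnell 2014, Thm. 11.3.17 in content) —
hypothesis `hAS`, a continuous global section of the espace étalé `FiberClass` of `R²ᵖ f_* ℂ`
through `(t, (e⁻¹)^* c)`. After it only EXISTING items and PROVED theorems are used: Hironaka over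
`ℚ̄` (`exists_isSmoothProjective_isOpenImmersion`), Deligne's global invariant cycle theorem = route
item `LinearSystemTorelli.DeligneGlobalInvariantCycles` (stmt-16363) with the proved Hodge lift,
number-field models (`Theorems.stub_numberFieldModel`), `HCOverNumberFields`, and pull-back of
algebraic classes = route item `BoundaryReadout.PullbackAlgebraic` (stmt-1071). No spreading, no base
change, no Riemann existence.

## Main result

* `absoluteReduction_of_absoluteSpreadSection` — `hAS` → D-item → P-item → `AbsoluteReduction`
  (CONDITIONAL: the gate records a `conditional-result`; the item stays open).

## References

* C. Voisin, *Hodge loci and absolute Hodge classes*, Compositio Math. 143 (2007), §3, proof of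
  Prop. 1.2 (arXiv math/0605766, p. 6). [Voisin2007HodgeLoci]
* F. Charles, C. Schnell, *Notes on absolute Hodge classes* (Math. Notes 49, 2014), Thm. 11.3.17,
  Thm. 11.3.19. [CharlesSchnell2014Notes]
* P. Deligne, *Théorie de Hodge II*, Publ. Math. IHÉS 40 (1971), Thm. 4.1.1. [DeligneHodgeII1971]
* H. Hironaka, Ann. of Math. 79 (1964), Main Theorem I. [Hironaka1964]
-/

-- every declaration of this problem lives in `Summit.HodgeConjecture.HodgeConjecture.…`
-- (single-problem summit: Problem = Summit), which `linter.dupNamespace` flags; set so that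
-- stand-alone elaboration is warning-free.
set_option linter.dupNamespace false

noncomputable section

namespace Summit.HodgeConjecture.HodgeConjecture.Theorems

open CategoryTheory CategoryTheory.Limits AlgebraicGeometry
open _root_.Topology
open Literature.AlgebraicGeometry Literature.AlgebraicGeometry.Motives
open Literature.AlgebraicGeometry.HodgeTheory
open Literature.AlgebraicTopology.SingularHomology
open Summit.HodgeConjecture.HodgeConjecture.Theses

/-- **The crux modulo Voisin's spread-with-a-global-flat-section (printed verbatim).** Hypothesis
`hAS` is the sentence opening Voisin's proof of Prop. 1.2 (Compositio 143 (2007), §3, for an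
absolute class): *"there exist smooth irreducible quasi-projective varieties `𝒳, T` defined over
`ℚ̄`, a projective morphism `π : 𝒳 → T`, and a locally constant global section
`α̃ ∈ H⁰(T, R^{2k}π_*ℚ)`, such that `X` is one fiber of `π` and `α` is the restriction of `α̃` to this
fiber"* (= Charles–Schnell Thm. 11.3.17 in content), on the tree's carriers: for `X` smooth
projective and `c` absolute Hodge there are `σ : ℚ̄ →+* ℂ`, a `ℚ̄`-morphism `f₀ : 𝒳₀ ⟶ T₀` of
quasi-projective `ℚ̄`-schemes with `T₀` smooth, `T₀ ⊗_σ ℂ` irreducible and `f₀ ⊗_σ ℂ` a smooth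
projective family of relative dimension `n`, a complex point `t`, an isomorphism `e : X ≅ 𝒳_t`, and
a CONTINUOUS global section of the espace étalé `FiberClass (f₀ ⊗ σ) (2p)` of `R²ᵖ f_* ℂ` through
`(t, (e⁻¹)^* c)`. With `hD` (partie fixe, route item stmt-16363) and `hP` (pull-back, route item
stmt-1071) the crux follows exactly as in `absoluteReduction_of_absoluteEtaleTrivialisation`, minus
the étale base change: a smooth projective compactification `i : 𝒳₀ ⊗ ℂ ↪ X̄₀ ⊗ ℂ` defined over
`ℚ̄` (Hironaka over `ℚ̄`, proved), the proved Hodge lift of the global section to a rational `(p,p)`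
class `β` on `X̄₀ ⊗ ℂ`, a number-field model of `X̄₀` (proved), `HCOverNumberFields`, and `hP` along
`𝒳_t ⟶ X̄₀ ⊗ ℂ` and along `e`. CONDITIONAL. [cite: Voisin2007HodgeLoci, §3, proof of Prop. 1.2 (first paragraph)]
[cite: CharlesSchnell2014Notes, Thm. 11.3.17 and Thm. 11.3.19] [cite: DeligneHodgeII1971, Théorème 4.1.1] -/
theorem absoluteReduction_of_absoluteSpreadSection
    (hAS : ∀ ⦃n : ℕ⦄ ⦃X : SchemeOver ℂ⦄, IsSmoothProjective n X →
      ∀ (p : ℕ) (c : complexBetti X (2 * p)), IsAbsoluteHodgeClass n X p c →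
        ∃ (σ : AlgebraicClosure ℚ →+* ℂ) (𝒳₀ T₀ : SchemeOver (AlgebraicClosure ℚ)) (f₀ : 𝒳₀ ⟶ T₀)
          (t : ComplexPoints ((baseChangeHom σ).obj T₀)) (e : X ≅ fiberOver ((baseChangeHom σ).map f₀) t),
          IsQuasiProjectiveOver 𝒳₀ ∧ IsQuasiProjectiveOver T₀ ∧
          IrreducibleSpace ((baseChangeHom σ).obj T₀).left ∧ AlgebraicGeometry.Smooth T₀.hom ∧
          IsSmoothProjectiveFamily ((baseChangeHom σ).map f₀) n ∧
          ∃ τ : ComplexPoints ((baseChangeHom σ).obj T₀) → FiberClass ((baseChangeHom σ).map f₀) (2 * p),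
            Continuous τ ∧ (∀ u, (τ u).pt = u) ∧ τ t = ⟨t, complexBetti.map e.inv (2 * p) c⟩)
    (hD : LinearSystemTorelli.DeligneGlobalInvariantCycles) (hP : BoundaryReadout.PullbackAlgebraic) :
    BoundaryReadout.AbsoluteReduction := by
  unfold BoundaryReadout.AbsoluteReduction
  intro hQ n X hX
  refine ⟨nonempty_hodgeModel_holds hX, fun p c hc ↦ ?_⟩
  obtain ⟨σ, 𝒳₀, T₀, f₀, t, e, h𝒳₀, hT₀, hirr, hsm, hf, τ, hτc, hτpt, hτt⟩ := hAS hX p c hc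
  have hXt : IsSmoothProjective n (fiberOver ((baseChangeHom σ).map f₀) t) := hf.isSmoothProjective t
  -- S1 (landed): `(e⁻¹)^* c` is absolute, in particular rational of type `(p,p)`
  have habs : IsAbsoluteHodgeClass n (fiberOver ((baseChangeHom σ).map f₀) t) p
      (complexBetti.map e.inv (2 * p) c) :=
    stub_absoluteOfIso e.symm hX hXt p c hc
  have h₀ : τ t ∈ locusOfHodgeClasses ((baseChangeHom σ).map f₀) n p := by
    rw [hτt]
    exact ⟨habs.1, habs.2.1⟩
  -- the base `T = T₀ ⊗ ℂ`: smooth of pure dimension `d`, quasi-projective, irreducible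
  haveI := hsm
  haveI := hirr
  haveI : IrreducibleSpace T₀.left := irreducibleSpace_of_irreducibleSpace_baseChangeHom_obj σ T₀
  obtain ⟨d, hd⟩ := Motives.exists_smoothOfRelativeDimension_of_smooth T₀.hom
  haveI := hd
  haveI hTd : SmoothOfRelativeDimension d ((baseChangeHom σ).obj T₀).hom :=
    smoothOfRelativeDimension_baseChangeHom_hom σ d T₀
  have hTqp : IsQuasiProjectiveOver ((baseChangeHom σ).obj T₀) := hT₀.baseChangeHom σ
  haveI : LocallyOfFiniteType ((baseChangeHom σ).obj T₀).hom := hTqp.locallyOfFiniteType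
  -- a smooth projective compactification of `𝒳₀` DEFINED OVER `ℚ̄` (Hironaka over `ℚ̄`, proved):
  -- `𝒳₀` is smooth (descent from `ℂ`), quasi-projective and irreducible (`𝒳₀ ⊗ ℂ` is)
  haveI : AlgebraicGeometry.Smooth ((baseChangeHom σ).map f₀).left := hf.smooth
  haveI : AlgebraicGeometry.Smooth f₀.left := smooth_of_smooth_baseChangeHom_map_left σ f₀
  haveI : AlgebraicGeometry.Smooth 𝒳₀.hom := by
    rw [← Over.w f₀]
    infer_instance
  haveI : IrreducibleSpace ((baseChangeHom σ).obj 𝒳₀).left :=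
    irreducibleSpace_of_isSmoothProjectiveFamily _ hf
  haveI : IrreducibleSpace 𝒳₀.left := irreducibleSpace_of_irreducibleSpace_baseChangeHom_obj σ 𝒳₀
  obtain ⟨m, hm⟩ := exists_smoothOfRelativeDimension_of_smooth 𝒳₀.hom
  obtain ⟨Xbar₀, i₀, hXbar₀, hi₀⟩ :=
    exists_isSmoothProjective_isOpenImmersion m 𝒳₀ hm h𝒳₀ inferInstance
  haveI := hi₀
  have hXbar : IsSmoothProjective m ((baseChangeHom σ).obj Xbar₀) :=
    IsSmoothProjective.baseChangeHom_holds σ hXbar₀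
  set i : (baseChangeHom σ).obj 𝒳₀ ⟶ (baseChangeHom σ).obj Xbar₀ := (baseChangeHom σ).map i₀ with hi_def
  haveI hi : IsOpenImmersion i.left := isOpenImmersion_baseChangeHom_map_left σ i₀
  -- global invariant cycles (route item stmt-16363) + the proved Hodge lift
  obtain ⟨β, hβr, hβh, hβσ⟩ :=
    (show deligne_globalInvariantCycles from hD).exists_hodgeClass_eq_globalSection_of_exists_isReal_hodgeModel
      exists_isReal_hodgeModel_holds hodgePQ_independent_of_hodgeModel_holds
      smoothProjective_hodgeStructure_isPolarizable_holds _ i hf hTqp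
      (SmoothOfRelativeDimension.smooth d _) hXbar hi hτc hτpt h₀
  have hα'eq : complexBetti.map e.inv (2 * p) c =
      complexBetti.map (fiberι ((baseChangeHom σ).map f₀) t ≫ i) (2 * p) β := by
    have h1 := hτt.symm.trans hβσ
    rw [(FiberClass.mk_eq_mk_iff _ _).1 h1, complexBetti.map_comp, ModuleCat.comp_apply]
  -- number-field model (N, proved) + HC over number fields ⇒ `β` algebraic
  obtain ⟨K, hK, hKn, ι₀, W₁, ⟨e₁⟩⟩ := stub_numberFieldModel Xbar₀ hXbar₀
  obtain ⟨e₂⟩ := Literature.Barriers.HodgeConjecture.nonempty_iso_baseChangeHom_baseChangeHom ι₀ σ W₁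
  have hHC : HodgeConjectureFor m ((baseChangeHom σ).obj Xbar₀) :=
    hQ hXbar ⟨K, hK, hKn, σ.comp ι₀, W₁, ⟨(baseChangeHom σ).mapIso e₁ ≪≫ e₂⟩⟩
  have hβalg : β ∈ algebraicClasses ((baseChangeHom σ).obj Xbar₀) p := hHC.2 p β hβr hβh
  -- P (route item stmt-1071): pull back along `𝒳_t ⟶ X̄₀ ⊗ ℂ`, then along `e.hom`
  have hα'alg := hP hXt hXbar (fiberι ((baseChangeHom σ).map f₀) t ≫ i) p β hβalg
  rw [← hα'eq] at hα'alg
  have key := hP hX hXt e.hom p _ hα'alg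
  rwa [e.complexBetti_map_hom_map_inv] at key

end Summit.HodgeConjecture.HodgeConjecture.Theorems

end
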